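import Summits.CriticalPhenomena.PercolationContinuityZ3.Theorems.PercNearOneGluingNoHeavyLowerTailAntitheticPendant
import HarnessLib

/-!
# `NoHeavyLowerTail` (stmt-CriticalPhenomena-4575) — antithetic cluster pairs: the FOUR-VALUE INEQUALITY and the BULK QUADRUPLE LEMMA of
# THEOREM C′ (prim-hp-2 gen 42; HOME/THEOREM-Cprime-delta2-cycle.md §4, MEMO-gen42 §1)

Support file (`--supports stmt-CriticalPhenomena-4575`, hull-port prover `prim-hp-2`, gen 42).  No definitions, no named facts, no sorries; standard
axioms.

THEOREM C′ (CONJECTURE Δ2 when `G − x` is a cycle through `s`) splits the change family into BULK classes and a boundary layer.  A bulk class consists of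
(up to) four colourings `rr, rb, br, bb` with clusters — after the pendant lifts `L_y = liftSet s y e`, `L_z = liftSet s z f` of …AntitheticChangeCube —
  `rr : (L_y A, ∅)`, `bb : (∅, L_z A)`, `rb : (L_y P, L_z Q)`, `br : (L_y Q, L_z P)`  with `P, Q ⊆ A`,
where `rb` is present only if `¬(y ⊳ P ∧ z ⊳ Q)` and `br` only if `¬(y ⊳ Q ∧ z ⊳ P)` (`u ⊳ C` : "`u = s` or `u` is an endpoint of a pair of `C`",
the condition under which `liftSet` adds the marker), and in a bulk class `y` (resp. `z`) is not seen by both `P` and `Q`.  This file proves that every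
such class has a nonnegative `Δ`-sum, for all monotone `F, G`, WITHOUT any cycle geometry:
* `Antithetic.Quad.four_value` — `Â·B̂ + (a − a′)(b − b′) ≥ 0` when `0 ≤ a, a′ ≤ Â`, `0 ≤ b, b′ ≤ B̂`;
* `Antithetic.Quad.arcs_pair`, `Antithetic.Quad.arcs_two_pairs` — an "arc" term `Δ(X, ∅)` pays for a cross pair it contains;
* `Antithetic.Quad.quad_lift_nonneg` — the bulk quadruple lemma above (case analysis on which arc pays for which pair).
[cite: VandenbergHaggstromKahn2005, §1 p. 3 (open cluster `C_s`)]
-/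

noncomputable section

namespace Summit.CriticalPhenomena.PercolationContinuityZ3.Theorems

open Literature.Probability.Percolation
open scoped Classical

namespace Antithetic

namespace Quad

/-- **Four-value inequality**: `0 ≤ Â·B̂ + (a − a′)(b − b′)` whenever `0 ≤ a, a′ ≤ Â` and `0 ≤ b, b′ ≤ B̂`. [this work] -/
theorem four_value {A B a a' b b' : ℝ} (ha0 : 0 ≤ a) (ha0' : 0 ≤ a') (hb0 : 0 ≤ b) (hb0' : 0 ≤ b') (ha : a ≤ A) (ha' : a' ≤ A)
    (hb : b ≤ B) (hb' : b' ≤ B) : 0 ≤ A * B + (a - a') * (b - b') := by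
  rcases le_total a' a with h1 | h1
  · rcases le_total b' b with h2 | h2
    · nlinarith [mul_nonneg (sub_nonneg.2 h1) (sub_nonneg.2 h2), mul_nonneg (ha0.trans ha) (hb0.trans hb)]
    · -- (a - a') ≥ 0, (b - b') ≤ 0 : |product| ≤ a * b' ≤ A * B
      nlinarith [mul_le_mul ha hb' hb0' (ha0.trans ha), mul_nonneg ha0' (sub_nonneg.2 h2), mul_nonneg (sub_nonneg.2 h1) hb0]
  · rcases le_total b' b with h2 | h2
    · nlinarith [mul_le_mul ha' hb hb0 (ha0'.trans ha'), mul_nonneg ha0 (sub_nonneg.2 h2), mul_nonneg (sub_nonneg.2 h1) hb0']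
    · nlinarith [mul_nonneg (sub_nonneg.2 h1) (sub_nonneg.2 h2), mul_nonneg (ha0.trans ha) (hb0.trans hb)]

variable {α : Type*} {F G : Set α → ℝ}

/-- An arc term pays for one cross pair it contains: `0 ≤ Δ(X, ∅) + Δ(X₁, X₁′)` for `X₁, X₁′ ⊆ X` (`Δ(S,T) = (F S − F T)(G S − G T)`). [this work] -/
theorem arcs_pair (hF : Monotone F) (hG : Monotone G) {X X₁ X₁' : Set α} (h1 : X₁ ⊆ X) (h1' : X₁' ⊆ X) :
    0 ≤ (F X - F ∅) * (G X - G ∅) + (F X₁ - F X₁') * (G X₁ - G X₁') := by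
  have e1 : (F X₁ - F X₁') * (G X₁ - G X₁') = ((F X₁ - F ∅) - (F X₁' - F ∅)) * ((G X₁ - G ∅) - (G X₁' - G ∅)) := by ring
  rw [e1]
  exact four_value (sub_nonneg.2 (hF (Set.empty_subset _))) (sub_nonneg.2 (hF (Set.empty_subset _)))
    (sub_nonneg.2 (hG (Set.empty_subset _))) (sub_nonneg.2 (hG (Set.empty_subset _)))
    (sub_le_sub_right (hF h1) _) (sub_le_sub_right (hF h1') _) (sub_le_sub_right (hG h1) _) (sub_le_sub_right (hG h1') _)

/-- Two arc terms pay for two cross pairs, one each. [this work] -/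
theorem arcs_two_pairs (hF : Monotone F) (hG : Monotone G) {X Y X₁ X₁' X₂ X₂' : Set α} (h1 : X₁ ⊆ X) (h1' : X₁' ⊆ X) (h2 : X₂ ⊆ Y)
    (h2' : X₂' ⊆ Y) :
    0 ≤ (F X - F ∅) * (G X - G ∅) + (F ∅ - F Y) * (G ∅ - G Y) + (F X₁ - F X₁') * (G X₁ - G X₁') + (F X₂ - F X₂') * (G X₂ - G X₂') := by
  have hA := arcs_pair hF hG h1 h1'
  have hB := arcs_pair hF hG h2 h2'
  have e : (F ∅ - F Y) * (G ∅ - G Y) = (F Y - F ∅) * (G Y - G ∅) := by ring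
  rw [e]
  linarith

/-- An arc term alone is nonnegative. [this work] -/
theorem arc_nonneg (hF : Monotone F) (hG : Monotone G) (X : Set α) : 0 ≤ (F X - F ∅) * (G X - G ∅) :=
  mul_nonneg (sub_nonneg.2 (hF (Set.empty_subset _))) (sub_nonneg.2 (hG (Set.empty_subset _)))

end Quad

namespace Quad

variable {V : Type*} {F G : Set (Sym2 V) → ℝ}

/-- `liftSet` does nothing when its base vertex is not seen. [this work] -/
theorem liftSet_of_not {s u : V} {e : Sym2 V} {C : Set (Sym2 V)} (h : ¬ (u = s ∨ ∃ g ∈ C, u ∈ g)) : Pendant.liftSet s u e C = C := by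
  unfold Pendant.liftSet; rw [if_neg h]

/-- **Bulk quadruple lemma of THEOREM C′.**  `P, Q ⊆ A`; `y` is not seen by both `P` and `Q`, nor is `z`; the `rb` member `(L_y P, L_z Q)` is present
unless `y ⊳ P ∧ z ⊳ Q`, the `br` member `(L_y Q, L_z P)` unless `y ⊳ Q ∧ z ⊳ P`.  Then
`Δ(L_y A, ∅) + Δ(∅, L_z A) + [rb]·Δ(L_y P, L_z Q) + [br]·Δ(L_y Q, L_z P) ≥ 0` for monotone `F, G`. [this work] -/
theorem quad_lift_nonneg (hF : Monotone F) (hG : Monotone G) (s y z : V) (e f : Sym2 V) {P Q A : Set (Sym2 V)} (hP : P ⊆ A) (hQ : Q ⊆ A)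
    (NY : ¬ ((y = s ∨ ∃ g ∈ P, y ∈ g) ∧ (y = s ∨ ∃ g ∈ Q, y ∈ g)))
    (NZ : ¬ ((z = s ∨ ∃ g ∈ P, z ∈ g) ∧ (z = s ∨ ∃ g ∈ Q, z ∈ g))) :
    0 ≤ (F (Pendant.liftSet s y e A) - F ∅) * (G (Pendant.liftSet s y e A) - G ∅) +
        (F ∅ - F (Pendant.liftSet s z f A)) * (G ∅ - G (Pendant.liftSet s z f A)) +
        (if ¬ ((y = s ∨ ∃ g ∈ P, y ∈ g) ∧ (z = s ∨ ∃ g ∈ Q, z ∈ g)) then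
          (F (Pendant.liftSet s y e P) - F (Pendant.liftSet s z f Q)) * (G (Pendant.liftSet s y e P) - G (Pendant.liftSet s z f Q)) else 0) +
        (if ¬ ((y = s ∨ ∃ g ∈ Q, y ∈ g) ∧ (z = s ∨ ∃ g ∈ P, z ∈ g)) then
          (F (Pendant.liftSet s y e Q) - F (Pendant.liftSet s z f P)) * (G (Pendant.liftSet s y e Q) - G (Pendant.liftSet s z f P)) else 0) := by
  have hyP : Pendant.liftSet s y e P ⊆ Pendant.liftSet s y e A := Pendant.liftSet_mono s y e hP
  have hyQ : Pendant.liftSet s y e Q ⊆ Pendant.liftSet s y e A := Pendant.liftSet_mono s y e hQ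
  have hzP : Pendant.liftSet s z f P ⊆ Pendant.liftSet s z f A := Pendant.liftSet_mono s z f hP
  have hzQ : Pendant.liftSet s z f Q ⊆ Pendant.liftSet s z f A := Pendant.liftSet_mono s z f hQ
  have hAy : A ⊆ Pendant.liftSet s y e A := Pendant.subset_liftSet s y e A
  have hAz : A ⊆ Pendant.liftSet s z f A := Pendant.subset_liftSet s z f A
  have arcB : (F ∅ - F (Pendant.liftSet s z f A)) * (G ∅ - G (Pendant.liftSet s z f A)) =
      (F (Pendant.liftSet s z f A) - F ∅) * (G (Pendant.liftSet s z f A) - G ∅) := by ring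
  -- the "plain" inclusions available when a marker is absent
  have plainP_y : ¬ (y = s ∨ ∃ g ∈ P, y ∈ g) → Pendant.liftSet s y e P ⊆ Pendant.liftSet s z f A :=
    fun h => by rw [liftSet_of_not h]; exact hP.trans hAz
  have plainQ_y : ¬ (y = s ∨ ∃ g ∈ Q, y ∈ g) → Pendant.liftSet s y e Q ⊆ Pendant.liftSet s z f A :=
    fun h => by rw [liftSet_of_not h]; exact hQ.trans hAz
  have plainP_z : ¬ (z = s ∨ ∃ g ∈ P, z ∈ g) → Pendant.liftSet s z f P ⊆ Pendant.liftSet s y e A :=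
    fun h => by rw [liftSet_of_not h]; exact hP.trans hAy
  have plainQ_z : ¬ (z = s ∨ ∃ g ∈ Q, z ∈ g) → Pendant.liftSet s z f Q ⊆ Pendant.liftSet s y e A :=
    fun h => by rw [liftSet_of_not h]; exact hQ.trans hAy
  have arcY := arc_nonneg hF hG (Pendant.liftSet s y e A)
  have arcZ := arc_nonneg hF hG (Pendant.liftSet s z f A)
  by_cases krb : (y = s ∨ ∃ g ∈ P, y ∈ g) ∧ (z = s ∨ ∃ g ∈ Q, z ∈ g)
  · -- rb absent
    rw [if_neg (not_not.2 krb)]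
    by_cases kbr : (y = s ∨ ∃ g ∈ Q, y ∈ g) ∧ (z = s ∨ ∃ g ∈ P, z ∈ g)
    · exact absurd ⟨krb.1, kbr.1⟩ NY
    · rw [if_pos kbr, add_zero]
      -- br = (L_y Q, L_z P): y is seen by P hence not by Q, so L_y Q = Q ⊆ L_z A; pay with the bb arc
      have hyQ' : ¬ (y = s ∨ ∃ g ∈ Q, y ∈ g) := fun h => NY ⟨krb.1, h⟩
      have h := arcs_pair hF hG (plainQ_y hyQ') hzP
      rw [arcB]
      linarith
  · rw [if_pos krb]
    by_cases kbr : (y = s ∨ ∃ g ∈ Q, y ∈ g) ∧ (z = s ∨ ∃ g ∈ P, z ∈ g)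
    · rw [if_neg (not_not.2 kbr), add_zero]
      -- rb present, br absent: y is seen by Q hence not by P, so L_y P = P ⊆ L_z A; pay with the bb arc
      have hyP' : ¬ (y = s ∨ ∃ g ∈ P, y ∈ g) := fun h => NY ⟨h, kbr.1⟩
      have h := arcs_pair hF hG (plainP_y hyP') hzQ
      rw [arcB]
      linarith
    · rw [if_pos kbr]
      -- both present: choose which arc pays for which pair
      by_cases hyP' : (y = s ∨ ∃ g ∈ P, y ∈ g)
      · -- z not seen by Q (rb kept), y not seen by Q (NY): rb ⊆ L_y A, br ⊆ L_z A
        have hzQ' : ¬ (z = s ∨ ∃ g ∈ Q, z ∈ g) := fun h => krb ⟨hyP', h⟩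
        have hyQ' : ¬ (y = s ∨ ∃ g ∈ Q, y ∈ g) := fun h => NY ⟨hyP', h⟩
        have h := arcs_two_pairs hF hG hyP (plainQ_z hzQ') (plainQ_y hyQ') hzP
        linarith
      · by_cases hyQ' : (y = s ∨ ∃ g ∈ Q, y ∈ g)
        · -- br kept gives: z not seen by P; br ⊆ L_y A, rb ⊆ L_z A
          have hzP' : ¬ (z = s ∨ ∃ g ∈ P, z ∈ g) := fun h => kbr ⟨hyQ', h⟩
          have h := arcs_two_pairs hF hG hyQ (plainP_z hzP') (plainP_y hyP') hzQ
          linarith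
        · -- y seen by neither P nor Q: use NZ to send one pair to L_y A
          by_cases hzQ' : (z = s ∨ ∃ g ∈ Q, z ∈ g)
          · have hzP' : ¬ (z = s ∨ ∃ g ∈ P, z ∈ g) := fun h => NZ ⟨h, hzQ'⟩
            -- br = (L_y Q, L_z P = P) ⊆ L_y A ; rb = (L_y P = P, L_z Q) ⊆ L_z A
            have h := arcs_two_pairs hF hG hyQ (plainP_z hzP') (plainP_y hyP') hzQ
            linarith
          · -- rb = (L_y P, L_z Q = Q) ⊆ L_y A ; br = (L_y Q = Q, L_z P) ⊆ L_z A
            have h := arcs_two_pairs hF hG hyP (plainQ_z hzQ') (plainQ_y hyQ') hzP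
            linarith

end Quad

end Antithetic

end Summit.CriticalPhenomena.PercolationContinuityZ3.Theorems
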